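import Summits.AtomisticToContinuum.Crystallization.Theorems.ThreeConeCertificateExactCertificateSlacknessEnergy
import Summits.AtomisticToContinuum.Crystallization.Theorems.ThreeConeCertificateExactCertificateNoGapNecessary

/-!
# `ExactCertificate` (stmt-AtomisticToContinuum-11959), negative side III: normal form, ranges, competitors

Refuter (cdisprove seat) companion, from the crux workfile `Cruxes/ExactCertificate/Disproof.lean`
(§2 normal form, §4 competitors, §5 ranges), built on `Negative/SplitBasics.lean` and the slackness
files `ThreeConeCertificateExactCertificateSlackness{Blocks,Energy}.lean`:
* NORMAL FORM `exactCertificate_iff_single` — the crux is a statement about ONE radial function: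
  `∃ P ρ f, f of positive type ∧ f ≤ V_LJ on [ρ,∞) ∧ (V_LJ − f)·1_{(0,ρ)} is (−e(P) − f 0/2)-stable`
  (`U := 0` below `ρ` WLOG; `g, U, c` determined by `f`); `kappa_le_of_single`;
* RANGES: `ExactAt ρ` is an up-set in `ρ` (`exactAt_mono`, `not_exactCertificate_iff_unbounded`: a kill must
  work at arbitrarily large ranges); a range below the minimal distance of `P` idles the finite-range cone
  (`c_eq_zero_of_range_le_minDist`), in particular `ρ ≤ 0` (`c_eq_zero_of_rho_nonpos`: two-cone sharpness);
* COMPETITORS: for every periodic `Q` the three block slacks are bounded by its excess energy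
  (`slacks_le_of_periodic`, `f_slack_le_of_periodic`) and `e_g(Q) + c ≤ e(Q) − e*`
  (`g_excess_le_of_periodic`) — the rigorous core of the "Barlow squeeze" (near-degenerate stackings force
  `𝓕f` to be `10⁻⁴`-small on all stacking rods).  All `[folklore]`.
-/

noncomputable section

namespace Summit.AtomisticToContinuum.Crystallization.Theorems.ExactCertificateNegative

open Literature.MathematicalPhysics.StatisticalMechanics
open Summit.AtomisticToContinuum.Crystallization.Theses.ThreeConeCertificate
open Summit.AtomisticToContinuum.Crystallization.Theorems.ChargedEnergyGapNegative
  (E3 eStar card_mul_eStar_le_interactionEnergy bddBelow_energyPerParticle_lennardJones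
    exists_trialState eStar_le le_energyPerParticle_of_tendsto)
open Summit.AtomisticToContinuum.Crystallization.Theorems.ChargedEnergyGapNegative.Blocks
  (BIdx bpt bpt_injective blockConfig blockConfig_apply blockConfig_injective card_BIdx
    IsDeep card_not_deep_le exists_block_energy_le siteSum siteSum_bpt sum_siteSum_eq depth)
open Summit.AtomisticToContinuum.Crystallization.Theorems.ThreeConeCertificateExactCertificate.Slackness
  (witness_eq slacks_le g_slack_le U_slack_le energyPerParticle_g_eq abs_two_mul_energy_block_sub_le
    nonpos_of_cubic_le_sq interactionEnergy_mono_pos)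
open Filter Topology
open scoped BigOperators

/-! ## Ranges -/

/-- The crux at a GIVEN range `ρ`. [folklore] -/
def ExactAt (ρ : ℝ) : Prop :=
  ∃ (P : PeriodicConfiguration 3) (c : ℝ) (g U f : ℝ → ℝ),
    IsSplit ρ c g U f ∧ c + f 0 / 2 = -(P.energyPerParticle lennardJones)

/-- `ExactCertificate ↔ ∃ ρ, ExactAt ρ`. [folklore] -/
theorem exactCertificate_iff_exists_exactAt : ExactCertificate ↔ ∃ ρ, ExactAt ρ := by
  rw [exactCertificate_iff]
  constructor
  · rintro ⟨P, ρ, c, g, U, f, h, h6⟩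
    exact ⟨ρ, P, c, g, U, f, h, h6⟩
  · rintro ⟨ρ, P, c, g, U, f, h, h6⟩
    exact ⟨P, ρ, c, g, U, f, h, h6⟩

/-- **Witness ranges form an up-set**: `ExactAt ρ → ExactAt ρ'` for `ρ ≤ ρ'` (same split).  A kill
must therefore refute `ExactAt ρ` for arbitrarily LARGE `ρ`; numerics at `ρ ≤ 5/2` cannot. [folklore] -/
theorem exactAt_mono {ρ ρ' : ℝ} (hρ : ρ ≤ ρ') (h : ExactAt ρ) : ExactAt ρ' := by
  obtain ⟨P, c, g, U, f, hs, hv⟩ := h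
  exact ⟨P, c, g, U, f, hs.mono hρ, hv⟩

/-- The kill criterion, recorded: `¬ExactCertificate ↔ ∀ ρ, ¬ExactAt ρ`, and by monotonicity it is
enough to refute `ExactAt` along any sequence of ranges tending to `+∞`. [folklore] -/
theorem not_exactCertificate_iff_unbounded :
    ¬ ExactCertificate ↔ ∀ n : ℕ, ¬ ExactAt n := by
  rw [exactCertificate_iff_exists_exactAt, not_exists]
  refine ⟨fun h n => h n, fun h ρ hρ => ?_⟩
  obtain ⟨n, hn⟩ := exists_nat_ge ρ
  exact h n (exactAt_mono hn hρ)


/-- **SHORT RANGES ARE TWO-CONE**: if the range `ρ` is at most the minimal distance of the witness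
configuration (no pair of `P` closer than `ρ`), then `e_g(P) = 0`, hence `c = 0` and `f 0/2 = −e*`:
the finite-range cone certifies nothing and the statement is the sharpness of a Bochner-type bound with
`f = V_LJ` on ALL of `D_P ∖ {0}` (by `f_eq_lennardJones_of_mem_points`).  So a witness with `c > 0` — the
only kind the route intends — needs `ρ > d_min(P)` (`ρ ≳ 0.97` for the expected hcp). [folklore] -/
theorem c_eq_zero_of_range_le_minDist {P : PeriodicConfiguration 3} {ρ c : ℝ} {g U f : ℝ → ℝ}
    (h : IsSplit ρ c g U f) (hv : c + f 0 / 2 ≤ -(P.energyPerParticle lennardJones))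
    (hmin : ∀ p ∈ P.points, ∀ q ∈ P.points, p ≠ q → ρ ≤ dist p q) :
    c = 0 ∧ f 0 / 2 = -eStar := by
  have hg : P.energyPerParticle g = 0 := by
    unfold PeriodicConfiguration.energyPerParticle
    have : ∀ x ∈ P.motif, ∑' q : {q : E3 // q ∈ P.points ∧ q ≠ x}, g (dist x q.1) = 0 := by
      intro x hx
      have h0 : ∀ q : {q : E3 // q ∈ P.points ∧ q ≠ x}, g (dist x q.1) = 0 := fun q =>
        h.g_zero _ (hmin x (P.mem_points_of_mem_motif hx) q.1 q.2.1 (fun heq => q.2.2 heq.symm))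
      simp only [h0, tsum_zero]
    rw [Finset.sum_congr rfl this]
    simp
  have h1 := energyPerParticle_g_eq h hv
  have hc : c = 0 := by linarith
  refine ⟨hc, ?_⟩
  have := (witness_eq h hv).2
  rw [hc] at this
  linarith

/-- **The two-cone sub-case `ρ ≤ 0` forces `c = 0`**: then `g ≡ 0` on `(0,∞)`, the `g`-energy of
every injective configuration vanishes, and the `g`-slack `c·N ≤ ε·N` gives `c ≤ ε` for all `ε`.
So `ExactAt ρ` with `ρ ≤ 0` says: the Fisher–Ruelle two-cone bound `E_LJ ≥ −N·f 0/2` is SHARP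
(`f 0/2 = −e*`), with a periodic optimiser. [folklore] -/
theorem c_eq_zero_of_rho_nonpos {P : PeriodicConfiguration 3} {ρ c : ℝ} {g U f : ℝ → ℝ}
    (h : IsSplit ρ c g U f) (hv : c + f 0 / 2 ≤ -(P.energyPerParticle lennardJones)) (hρ : ρ ≤ 0) :
    c = 0 ∧ f 0 / 2 = -eStar := by
  have hc : c = 0 := by
    refine le_antisymm (le_of_forall_pos_le_add fun ε hε => ?_) h.c_nonneg
    obtain ⟨K₀, hK₀, hK⟩ := g_slack_le h hv hε
    have h1 := hK K₀ le_rfl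
    have hg0 : interactionEnergy g (blockConfig P K₀) = 0 := by
      rw [interactionEnergy_congr_pos (W := fun _ => 0) (fun r hr => h.g_zero r (by linarith))
        (blockConfig_injective P K₀)]
      simp [interactionEnergy]
    rw [hg0, zero_add] at h1
    have hn : (0 : ℝ) < Fintype.card (BIdx P K₀) := by
      rw [card_BIdx]; exact_mod_cast Nat.mul_pos P.motif_nonempty.card_pos (pow_pos hK₀ 3)
    have := le_of_mul_le_mul_right (by linarith : c * Fintype.card (BIdx P K₀) ≤
      ε * Fintype.card (BIdx P K₀)) hn
    linarith
  refine ⟨hc, ?_⟩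
  have := (witness_eq h hv).2
  rw [hc] at this
  linarith

/-! ## Competitors -/

/-- **EVERY PERIODIC COMPETITOR'S SLACKS ARE BOUNDED BY ITS EXCESS ENERGY** (the rigorous core of the
"Barlow squeeze"): for a witness and ANY periodic configuration `Q`, along the `K`-blocks of `Q` the three
slacks satisfy eventually `(E_g + c·N) + E_U + (E_f + N·f 0/2) ≤ (e(Q) − e* + ε)·N`, each bracket `≥ 0`.
For the Barlow polytypes (`e(Q) − e* ≈ 10⁻⁴…10⁻⁵`) this forces the Bochner form of `f` to be `10⁻⁴`-small
on all stacking-dependent Bragg rods, i.e. `𝓕f` essentially band-limited to `|k| ≲ 4π/(√3·a)`, while `f`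
must still touch `V_LJ` from below at every distance of `P` beyond `ρ` (see the module docstring). [folklore] -/
theorem slacks_le_of_periodic {P : PeriodicConfiguration 3} {ρ c : ℝ} {g U f : ℝ → ℝ}
    (h : IsSplit ρ c g U f) (hv : c + f 0 / 2 ≤ -(P.energyPerParticle lennardJones))
    (Q : PeriodicConfiguration 3) {ε : ℝ} (hε : 0 < ε) :
    ∃ K₀ : ℕ, 0 < K₀ ∧ ∀ K : ℕ, K₀ ≤ K →
      (interactionEnergy g (blockConfig Q K) + c * Fintype.card (BIdx Q K)) +
        interactionEnergy U (blockConfig Q K) +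
        (interactionEnergy f (blockConfig Q K) + Fintype.card (BIdx Q K) * f 0 / 2) ≤
      (Q.energyPerParticle lennardJones - eStar + ε) * Fintype.card (BIdx Q K) := by
  obtain ⟨K₀, hK₀, hK⟩ := exists_block_energy_le Q hε
  refine ⟨K₀, hK₀, fun K hKK => ?_⟩
  have h1 := hK K hKK
  rw [h.energy_eq (blockConfig_injective Q K)] at h1
  have h2 := (witness_eq h hv).2
  nlinarith [h1, h2]

/-- In particular the **Bochner slack of a competitor**: `E_f(Q_K) + N·f 0/2 ≤ (e(Q) − e* + ε)·N`
eventually — a periodic `Q` whose energy is within `δ` of the optimum has `(1/N)Σᵢⱼ f(xᵢ − xⱼ) ≤ 2δ`,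
i.e. `Σ_{G ∈ Λ_Q^*} 𝓕f(|G|)|S_Q(G)|² ≲ 2δ` in Fourier language. [folklore] -/
theorem f_slack_le_of_periodic {P : PeriodicConfiguration 3} {ρ c : ℝ} {g U f : ℝ → ℝ}
    (h : IsSplit ρ c g U f) (hv : c + f 0 / 2 ≤ -(P.energyPerParticle lennardJones))
    (Q : PeriodicConfiguration 3) {ε : ℝ} (hε : 0 < ε) :
    ∃ K₀ : ℕ, 0 < K₀ ∧ ∀ K : ℕ, K₀ ≤ K →
      interactionEnergy f (blockConfig Q K) + Fintype.card (BIdx Q K) * f 0 / 2 ≤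
        (Q.energyPerParticle lennardJones - eStar + ε) * Fintype.card (BIdx Q K) := by
  obtain ⟨K₀, hK₀, hK⟩ := slacks_le_of_periodic h hv Q hε
  refine ⟨K₀, hK₀, fun K hKK => ?_⟩
  have h1 := hK K hKK
  have h2 := h.stable _ _ (blockConfig_injective Q K)
  have h3 := h.U_energy_nonneg (blockConfig_injective Q K)
  linarith

/-- … and the **finite-range slack of a competitor**: `E_g(Q_K) + c·N ≤ (e(Q) − e* + ε)·N` eventually,
whence (finite-range block identity) `e_g(Q) + c ≤ e(Q) − e*`: the finite-range part must rate every
periodic competitor within its TOTAL excess energy — for `ρ < √(8/3)·a` it rates fcc and hcp equally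
(identical pair statistics below the third shell), so then `U`- and `f`-slacks of fcc carry all of
`e(fcc) − e(hcp) ≈ 7·10⁻⁵`. [folklore] -/
theorem g_excess_le_of_periodic {P : PeriodicConfiguration 3} {ρ c : ℝ} {g U f : ℝ → ℝ}
    (h : IsSplit ρ c g U f) (hv : c + f 0 / 2 ≤ -(P.energyPerParticle lennardJones))
    (Q : PeriodicConfiguration 3) :
    Q.energyPerParticle g + c ≤ Q.energyPerParticle lennardJones - eStar := by
  set F : ℝ := (Q.motif.card : ℝ) with hFdef
  have hF : 0 < F := by rw [hFdef]; exact_mod_cast Q.motif_nonempty.card_pos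
  set C : ℝ := 6 * depth Q ρ * ∑ x ∈ Q.motif, siteSum Q (fun r => |g r|) x with hCdef
  have hblock : ∀ K : ℕ, |2 * interactionEnergy g (blockConfig Q K) -
      (K : ℝ) ^ 3 * (2 * F * Q.energyPerParticle g)| ≤ C * (K : ℝ) ^ 2 := by
    intro K
    have := abs_two_mul_energy_block_sub_le Q h.g_zero K
    rw [hCdef]
    calc _ ≤ 6 * depth Q ρ * (K : ℝ) ^ 2 * ∑ x ∈ Q.motif, siteSum Q (fun r => |g r|) x := this
      _ = _ := by ring
  have hcard : ∀ K : ℕ, ((Fintype.card (BIdx Q K) : ℕ) : ℝ) = F * (K : ℝ) ^ 3 := fun K => by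
    rw [card_BIdx]; push_cast; rw [hFdef]
  set δ : ℝ := Q.energyPerParticle lennardJones - eStar with hδ
  have key : ∀ ε : ℝ, 0 < ε → Q.energyPerParticle g + c - δ - ε ≤ 0 := by
    intro ε hε
    obtain ⟨K₀, -, hK⟩ := slacks_le_of_periodic h hv Q hε
    have : 2 * F * (Q.energyPerParticle g + c - δ - ε) ≤ 0 := by
      refine nonpos_of_cubic_le_sq (b := C) ⟨K₀, fun K hKK => ?_⟩
      have h1 := hK K hKK
      have h2 := h.U_energy_nonneg (blockConfig_injective Q K)
      have h3 := h.f_energy_ge (blockConfig Q K)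
      rw [hcard] at h1 h3
      have h4 := (abs_le.1 (hblock K)).1
      nlinarith [h1, h2, h3, h4]
    nlinarith
  have : Q.energyPerParticle g + c - δ ≤ 0 := le_of_forall_pos_le_add fun ε hε => by
    have := key ε hε; linarith
  linarith

/-! ### Normal form: the crux is about ONE radial function -/

/-- The truncated remainder `(V_LJ − f)·1_{(0,ρ)}`: the canonical finite-range part of a split. [folklore] -/
def gOf (ρ : ℝ) (f : ℝ → ℝ) (r : ℝ) : ℝ := if r < ρ then lennardJones r - f r else 0

/-- **NORMAL FORM — THE CRUX IS A STATEMENT ABOUT ONE RADIAL FUNCTION `f`**: `U` may be taken `0` below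
`ρ` and `g, U, c` are then determined by `f`:
`ExactCertificate ↔ ∃ P ρ f, f radially of positive type ∧ f ≤ V_LJ on [ρ,∞) ∩ (0,∞) ∧
 (V_LJ − f)·1_{(0,ρ)} is (−e(P) − f 0/2)-stable`, i.e. `(e(P) + f 0/2)·N ≤ Σ_{i<j, d<ρ} (V_LJ − f)(d_ij)`
for every injective `x`.  (`→`: move `U·1_{(0,ρ)} ≥ 0` into `g`; `←`: `g := (V−f)1_{(0,ρ)}`,
`U := (V−f)1_{[ρ,∞)}`, `c := −e(P) − f 0/2`.) [folklore] -/
theorem exactCertificate_iff_single :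
    ExactCertificate ↔ ∃ (P : PeriodicConfiguration 3) (ρ : ℝ) (f : ℝ → ℝ),
      (∀ (n : ℕ) (y : Fin n → E3) (w : Fin n → ℝ), 0 ≤ ∑ i, ∑ j, w i * w j * f (dist (y i) (y j))) ∧
      (∀ r, ρ ≤ r → 0 < r → f r ≤ lennardJones r) ∧
      (∀ (N : ℕ) (x : Fin N → E3), Function.Injective x →
        (P.energyPerParticle lennardJones + f 0 / 2) * N ≤ interactionEnergy (gOf ρ f) x) := by
  rw [exactCertificate_iff]
  constructor
  · rintro ⟨P, ρ, c, g, U, f, hs, hv⟩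
    refine ⟨P, ρ, f, hs.posType, fun r hρ hr => hs.f_le_tail hρ hr, fun N x hx => ?_⟩
    have hmono : interactionEnergy g x ≤ interactionEnergy (gOf ρ f) x := by
      refine interactionEnergy_mono_pos (fun r hr => ?_) hx
      unfold gOf
      split_ifs with hlt
      · have h1 := hs.split r hr
        have h2 := hs.U_nonneg r hr
        linarith
      · exact (hs.g_zero r (not_lt.1 hlt)).le
    have hst := hs.stable N x hx
    have he : P.energyPerParticle lennardJones = -(c + f 0 / 2) := by linarith
    have : (P.energyPerParticle lennardJones + f 0 / 2) * N = -(c * N) := by rw [he]; ring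
    rw [this]
    exact hst.trans hmono
  · rintro ⟨P, ρ, f, hpd, htail, hstab⟩
    refine ⟨P, ρ, -(P.energyPerParticle lennardJones) - f 0 / 2, gOf ρ f,
      fun r => if r < ρ then 0 else lennardJones r - f r, f, ⟨?_, ?_, ?_, hpd, ?_⟩, by ring⟩
    · intro r _
      show lennardJones r = gOf ρ f r + (if r < ρ then 0 else lennardJones r - f r) + f r
      unfold gOf
      split_ifs <;> ring
    · intro r hr
      show 0 ≤ (if r < ρ then 0 else lennardJones r - f r)
      split_ifs with hlt
      · exact le_rfl
      · have := htail r (not_lt.1 hlt) hr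
        linarith
    · intro r hρ
      unfold gOf
      rw [if_neg (not_lt.2 hρ)]
    · intro N x hx
      have := hstab N x hx
      have e1 : -((-P.energyPerParticle lennardJones - f 0 / 2) * (N : ℝ)) =
          (P.energyPerParticle lennardJones + f 0 / 2) * N := by ring
      rw [e1]
      exact this

/-- In the normal form the value floor reads: **`−e* ≤ −e(P)`… no — it reads `e(P) + f 0/2 ≥ …`**;
precisely, for ANY `ρ, f` with `f` of positive type and `f ≤ V_LJ` on the tail, and any real `κ` with
`κ·N ≤ E_{gOf ρ f}(x)` for all injective `x`, one has `κ ≤ e* + f 0/2` (so `κ = e(P) + f 0/2` forces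
`e(P) = e*`). [folklore] -/
theorem kappa_le_of_single {ρ κ : ℝ} {f : ℝ → ℝ}
    (hpd : ∀ (n : ℕ) (y : Fin n → E3) (w : Fin n → ℝ), 0 ≤ ∑ i, ∑ j, w i * w j * f (dist (y i) (y j)))
    (htail : ∀ r, ρ ≤ r → 0 < r → f r ≤ lennardJones r)
    (hstab : ∀ (N : ℕ) (x : Fin N → E3), Function.Injective x → κ * N ≤ interactionEnergy (gOf ρ f) x) :
    κ ≤ eStar + f 0 / 2 := by
  have hs : IsSplit ρ (-κ) (gOf ρ f) (fun r => if r < ρ then 0 else lennardJones r - f r) f := by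
    refine ⟨?_, ?_, ?_, hpd, ?_⟩
    · intro r _
      show lennardJones r = gOf ρ f r + (if r < ρ then 0 else lennardJones r - f r) + f r
      unfold gOf
      split_ifs <;> ring
    · intro r hr
      show 0 ≤ (if r < ρ then 0 else lennardJones r - f r)
      split_ifs with hlt
      · exact le_rfl
      · have := htail r (not_lt.1 hlt) hr
        linarith
    · intro r hρ
      unfold gOf
      rw [if_neg (not_lt.2 hρ)]
    · intro N x hx
      have := hstab N x hx
      have e1 : -((-κ) * (N : ℝ)) = κ * N := by ring
      rw [e1]
      exact this
  have := hs.value_ge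
  linarith


end Summit.AtomisticToContinuum.Crystallization.Theorems.ExactCertificateNegative

end
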